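import Mathlib.Analysis.FunctionalSpaces.SobolevInequality
import Mathlib.MeasureTheory.Function.LpSpace.Complete
import Mathlib.MeasureTheory.Function.LpSeminorm.CompareExp
import Mathlib.Analysis.Calculus.LocalExtr.Basic
import Literature.Analysis.FluidPDE.SobolevWholeSpace
import HarnessLib

/-!
# The Gagliardo–Nirenberg–Sobolev inequality `‖u‖_{L⁶} ≤ K‖Du‖_{L²}` on a three-dimensional space
# for fields that are merely in `L⁶`

Analysis/FluidPDE support file (sequel of `SobolevWholeSpace`). The tree's
`Literature.Analysis.FluidPDE.eLpNorm_six_le_eLpNorm_fderiv_two` removes the compact-support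
hypothesis of Mathlib's Gagliardo–Nirenberg–Sobolev inequality at the price of `u ∈ L²` ("any decay
ruling out the constants would do; `L²` is what the energy class provides"). Here the decay
hypothesis is the NATURAL one, membership in the target space `L⁶` itself — the homogeneous Sobolev
space `Ḣ¹(ℝ³)` is exactly the space of `L⁶` functions with `L²` gradient — which is what
self-similar / Type-I profiles of the Navier–Stokes equations provide (`|U(y)| ∼ |y|⁻¹` is in `L⁶`,
not in `L²`).

* `eLpNorm_six_le_eLpNorm_fderiv_two_of_eLpNorm_six_lt_top` — on a `3`-dimensional real inner
  product space with an additive Haar measure, every `C¹` map `u` with `‖u‖_{L⁶} < ∞` satisfies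
  `‖u‖_{L⁶} ≤ K‖Du‖_{L²}`, `K = SNormLESNormFDerivOfEqConst F μ 2` (Mathlib's constant).

Proof (Evans, *PDE*, §5.6.1, truncation): with the smooth cut-offs `χ_R` (`= 1` on `B̄_R`, `= 0`
off `B_{2R}`, `‖Dχ_R‖ ≤ C/R`), `Dχ_R` is supported in the shell `S_R = {R < ‖x‖ < 2R}` (the cut-off
attains its extrema `1`, `0` elsewhere), so `‖D(χ_R u)‖₂ ≤ ‖Du‖₂ + (C/R)‖1_{S_R}u‖₂`; Hölder on the
shell, `‖1_{S_R}u‖₂ ≤ ‖1_{S_R}u‖₆ μ(B_{2R})^{1/3} = 2R·μ(B₁)^{1/3}‖1_{S_R}u‖₆`, turns the collar into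
`2Cμ(B₁)^{1/3}‖1_{‖x‖>R}u‖₆ → 0` (tail of an `L⁶` function, dominated convergence); Mathlib's
inequality for `χ_R u ∈ C¹_c` and Fatou in `L⁶` (`Lp.eLpNorm_lim_le_liminf_eLpNorm`) conclude.

## References
* L. C. Evans, *Partial Differential Equations*, 2nd ed. (2010), §5.6.1, Thm. 1–2.
* G. Talenti, Ann. Mat. Pura Appl. 110 (1976) (the sharp constant; not used).
-/

noncomputable section

open MeasureTheory Filter Topology Set Function Module Metric
open scoped ENNReal NNReal

namespace Literature.Analysis.FluidPDE

variable {E : Type*} [NormedAddCommGroup E] [InnerProductSpace ℝ E] [FiniteDimensional ℝ E]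
  [MeasurableSpace E] [BorelSpace E]
variable {F : Type*} [NormedAddCommGroup F] [NormedSpace ℝ F] [FiniteDimensional ℝ F]

omit [FiniteDimensional ℝ E] [MeasurableSpace E] [BorelSpace E] in
/-- The gradient of the cut-off `χ_R` vanishes off the open shell `R < ‖x‖ < 2R`: on `‖x‖ ≤ R` the
cut-off attains its maximum `1`, on `‖x‖ ≥ 2R` its minimum `0` (`0 ≤ χ_R ≤ 1`), and the derivative
vanishes at extrema. [folklore] -/
private theorem fderiv_cutoff_eq_zero_of_not_mem_shell {R : ℝ} (hR : 0 < R) {x : E}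
    (hx : x ∉ {y : E | R < ‖y‖ ∧ ‖y‖ < 2 * R}) : fderiv ℝ (cutoff R) x = 0 := by
  simp only [mem_setOf_eq, not_and_or, not_lt] at hx
  rcases hx with h | h
  · -- maximum point
    have hmax : IsLocalMax (cutoff (E := E) R) x :=
      Filter.Eventually.of_forall fun y => by
        rw [cutoff_eq_one hR h]; exact cutoff_le_one R y
    exact hmax.fderiv_eq_zero
  · -- minimum point
    have hmin : IsLocalMin (cutoff (E := E) R) x :=
      Filter.Eventually.of_forall fun y => by
        rw [cutoff_eq_zero hR h]; exact cutoff_nonneg R y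
    exact hmin.fderiv_eq_zero

omit [FiniteDimensional ℝ E] [MeasurableSpace E] [BorelSpace E] [FiniteDimensional ℝ F] in
/-- Truncation with the shell indicator: `‖D(χ_R u)(x)‖ ≤ ‖Du(x)‖ + (C/R)‖(1_{S_R}u)(x)‖`,
`S_R = {R < ‖x‖ < 2R}`. [cite: Evans2010, §5.6.1 proof of Thm. 2] -/
theorem norm_fderiv_cutoff_smul_le_indicator {u : E → F} (hu : ContDiff ℝ 1 u) {C R : ℝ}
    (hR : 0 < R) (hC0 : 0 ≤ C) (hC : ∀ x : E, ‖fderiv ℝ (cutoff R) x‖ ≤ C / R) (x : E) :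
    ‖fderiv ℝ (fun y => cutoff R y • u y) x‖ ≤
      ‖fderiv ℝ u x‖ + C / R * ‖({y : E | R < ‖y‖ ∧ ‖y‖ < 2 * R}).indicator u x‖ := by
  have hχ : DifferentiableAt ℝ (cutoff (E := E) R) x :=
    ((contDiff_cutoff (n := 1) R).differentiable one_ne_zero) x
  have hux : DifferentiableAt ℝ u x := (hu.differentiable one_ne_zero) x
  rw [fderiv_fun_smul hχ hux]
  refine (norm_add_le _ _).trans (add_le_add ?_ ?_)
  · rw [norm_smul, Real.norm_eq_abs]
    exact mul_le_of_le_one_left (norm_nonneg _) (abs_cutoff_le_one R x)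
  · rw [ContinuousLinearMap.norm_smulRight_apply]
    by_cases hx : x ∈ {y : E | R < ‖y‖ ∧ ‖y‖ < 2 * R}
    · rw [indicator_of_mem hx]
      exact mul_le_mul_of_nonneg_right (hC x) (norm_nonneg _)
    · rw [fderiv_cutoff_eq_zero_of_not_mem_shell hR hx, norm_zero, zero_mul]
      positivity

omit [FiniteDimensional ℝ E] in
/-- The `L²` form of the truncation bound with the shell indicator:
`‖D(χ_R u)‖_{L²} ≤ ‖Du‖_{L²} + (C/R)‖1_{S_R}u‖_{L²}`. [cite: Evans2010, §5.6.1 proof of Thm. 2] -/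
theorem eLpNorm_fderiv_cutoff_smul_le_indicator (μ : Measure E) {u : E → F} (hu : ContDiff ℝ 1 u)
    {C R : ℝ} (hC0 : 0 ≤ C) (hR : 0 < R) (hC : ∀ x : E, ‖fderiv ℝ (cutoff R) x‖ ≤ C / R) :
    eLpNorm (fderiv ℝ fun y => cutoff R y • u y) 2 μ ≤
      eLpNorm (fderiv ℝ u) 2 μ +
        ENNReal.ofReal (C / R) * eLpNorm (({y : E | R < ‖y‖ ∧ ‖y‖ < 2 * R}).indicator u) 2 μ := by
  have hS : MeasurableSet {y : E | R < ‖y‖ ∧ ‖y‖ < 2 * R} :=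
    (isOpen_lt continuous_const continuous_norm).inter (isOpen_lt continuous_norm continuous_const)
      |>.measurableSet
  have hmeas₁ : AEStronglyMeasurable (fun x => ‖fderiv ℝ u x‖) μ :=
    (hu.continuous_fderiv one_ne_zero).norm.aestronglyMeasurable
  have hmeas₂ : AEStronglyMeasurable
      (fun x => C / R * ‖({y : E | R < ‖y‖ ∧ ‖y‖ < 2 * R}).indicator u x‖) μ :=
    (((hu.continuous.aestronglyMeasurable).indicator hS).norm).const_mul _
  calc eLpNorm (fderiv ℝ fun y => cutoff R y • u y) 2 μ
      ≤ eLpNorm (fun x => ‖fderiv ℝ u x‖ +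
          C / R * ‖({y : E | R < ‖y‖ ∧ ‖y‖ < 2 * R}).indicator u x‖) 2 μ :=
        eLpNorm_mono_real (norm_fderiv_cutoff_smul_le_indicator hu hR hC0 hC)
    _ ≤ eLpNorm (fun x => ‖fderiv ℝ u x‖) 2 μ +
          eLpNorm (fun x => C / R * ‖({y : E | R < ‖y‖ ∧ ‖y‖ < 2 * R}).indicator u x‖) 2 μ :=
        eLpNorm_add_le hmeas₁ hmeas₂ (by norm_num)
    _ = eLpNorm (fderiv ℝ u) 2 μ +
          ENNReal.ofReal (C / R) * eLpNorm (({y : E | R < ‖y‖ ∧ ‖y‖ < 2 * R}).indicator u) 2 μ := by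
        rw [eLpNorm_norm]
        congr 1
        have : (fun x => C / R * ‖({y : E | R < ‖y‖ ∧ ‖y‖ < 2 * R}).indicator u x‖) =
            (C / R) • fun x => ‖({y : E | R < ‖y‖ ∧ ‖y‖ < 2 * R}).indicator u x‖ := rfl
        rw [this, eLpNorm_const_smul, eLpNorm_norm, Real.enorm_eq_ofReal (by positivity)]

omit [NormedSpace ℝ F] [FiniteDimensional ℝ F] in
/-- **Hölder on the shell.** On a `3`-dimensional space with an additive Haar measure:
`‖1_{S_R}u‖_{L²} ≤ 2R·μ(B₁)^{1/3}·‖1_{‖x‖>R}u‖_{L⁶}` for `S_R = {R < ‖x‖ < 2R} ⊂ B_{2R}`,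
`μ(B_{2R}) = (2R)³μ(B₁)`. [folklore] -/
private theorem eLpNorm_two_indicator_shell_le (μ : Measure E) [μ.IsAddHaarMeasure] (hE : finrank ℝ E = 3)
    {u : E → F} (hu : AEStronglyMeasurable u μ) {R : ℝ} (hR : 0 < R) :
    eLpNorm (({y : E | R < ‖y‖ ∧ ‖y‖ < 2 * R}).indicator u) 2 μ ≤
      ENNReal.ofReal (2 * R) * μ (ball (0 : E) 1) ^ (1 / 3 : ℝ) *
        eLpNorm (({y : E | R < ‖y‖}).indicator u) 6 μ := by
  set S : Set E := {y : E | R < ‖y‖ ∧ ‖y‖ < 2 * R} with hSdef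
  have hSo : IsOpen S :=
    (isOpen_lt continuous_const continuous_norm).inter (isOpen_lt continuous_norm continuous_const)
  have hS : MeasurableSet S := hSo.measurableSet
  have hT : MeasurableSet {y : E | R < ‖y‖} := (isOpen_lt continuous_const continuous_norm).measurableSet
  -- Hölder on the finite-measure set `S`
  have h1 : eLpNorm (S.indicator u) 2 μ ≤ eLpNorm (S.indicator u) 6 μ * μ S ^ (1 / 3 : ℝ) := by
    rw [eLpNorm_indicator_eq_eLpNorm_restrict hS, eLpNorm_indicator_eq_eLpNorm_restrict hS]
    have h := eLpNorm_le_eLpNorm_mul_rpow_measure_univ (μ := μ.restrict S) (p := 2) (q := 6)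
      (by norm_num) hu.restrict
    rw [Measure.restrict_apply_univ] at h
    have e : (1 / (2 : ℝ≥0∞).toReal - 1 / (6 : ℝ≥0∞).toReal : ℝ) = 1 / 3 := by norm_num
    rwa [e] at h
  -- `μ S ≤ μ (ball 0 (2R)) = (2R)³ μ (ball 0 1)`
  have hSsub : S ⊆ ball (0 : E) (2 * R) := fun y hy => by
    rw [mem_ball_zero_iff]; exact hy.2
  have h2 : μ S ^ (1 / 3 : ℝ) ≤ ENNReal.ofReal (2 * R) * μ (ball (0 : E) 1) ^ (1 / 3 : ℝ) := by
    have hb : μ (ball (0 : E) (2 * R)) = ENNReal.ofReal ((2 * R) ^ 3) * μ (ball (0 : E) 1) := by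
      rw [Measure.addHaar_ball_of_pos μ (0 : E) (by positivity : 0 < 2 * R), hE]
    calc μ S ^ (1 / 3 : ℝ) ≤ μ (ball (0 : E) (2 * R)) ^ (1 / 3 : ℝ) :=
          ENNReal.rpow_le_rpow (measure_mono hSsub) (by norm_num)
      _ = ENNReal.ofReal (2 * R) * μ (ball (0 : E) 1) ^ (1 / 3 : ℝ) := by
          rw [hb, ENNReal.mul_rpow_of_nonneg _ _ (by norm_num : (0 : ℝ) ≤ 1 / 3),
            ENNReal.ofReal_rpow_of_nonneg (by positivity) (by norm_num), ← Real.rpow_natCast,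
            ← Real.rpow_mul (by positivity)]
          norm_num
  -- the shell indicator is dominated by the tail indicator
  have h3 : eLpNorm (S.indicator u) 6 μ ≤ eLpNorm (({y : E | R < ‖y‖}).indicator u) 6 μ := by
    refine eLpNorm_mono fun x => ?_
    rw [norm_indicator_eq_indicator_norm, norm_indicator_eq_indicator_norm]
    exact indicator_le_indicator_of_subset (fun y hy => hy.1) (fun _ => norm_nonneg _) x
  calc eLpNorm (S.indicator u) 2 μ ≤ eLpNorm (S.indicator u) 6 μ * μ S ^ (1 / 3 : ℝ) := h1
    _ ≤ eLpNorm (({y : E | R < ‖y‖}).indicator u) 6 μ *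
          (ENNReal.ofReal (2 * R) * μ (ball (0 : E) 1) ^ (1 / 3 : ℝ)) := mul_le_mul' h3 h2
    _ = ENNReal.ofReal (2 * R) * μ (ball (0 : E) 1) ^ (1 / 3 : ℝ) *
          eLpNorm (({y : E | R < ‖y‖}).indicator u) 6 μ := by ring

omit [InnerProductSpace ℝ E] [FiniteDimensional ℝ E] [NormedSpace ℝ F] [FiniteDimensional ℝ F] in
/-- **The `L⁶` tail of an `L⁶` function tends to zero**: `‖1_{‖x‖>n+1}u‖_{L⁶} → 0` (dominated
convergence for `∫ 1_{‖x‖>n+1}‖u‖⁶`). [folklore] -/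
private theorem tendsto_eLpNorm_indicator_tail_six (μ : Measure E) {u : E → F} (hum : AEStronglyMeasurable u μ)
    (hu6 : eLpNorm u 6 μ < ∞) :
    Tendsto (fun n : ℕ => eLpNorm (({y : E | (n : ℝ) + 1 < ‖y‖}).indicator u) 6 μ) atTop (𝓝 0) := by
  have hT : ∀ n : ℕ, MeasurableSet {y : E | (n : ℝ) + 1 < ‖y‖} := fun n =>
    (isOpen_lt continuous_const continuous_norm).measurableSet
  -- the lower Lebesgue integrals
  set G : ℕ → E → ℝ≥0∞ := fun n x => ‖({y : E | (n : ℝ) + 1 < ‖y‖}).indicator u x‖ₑ ^ (6 : ℝ)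
    with hGdef
  have hbound : ∫⁻ x, ‖u x‖ₑ ^ (6 : ℝ) ∂μ ≠ ⊤ := by
    have h := (eLpNorm_lt_top_iff_lintegral_rpow_enorm_lt_top (by norm_num) (by norm_num)).1 hu6
    simpa using h.ne
  have hGle : ∀ n, ∀ x, G n x ≤ ‖u x‖ₑ ^ (6 : ℝ) := fun n x => by
    refine ENNReal.rpow_le_rpow ?_ (by norm_num)
    rw [enorm_indicator_eq_indicator_enorm]
    exact indicator_le_self _ _ x
  have hGmeas : ∀ n, AEMeasurable (G n) μ := fun n =>
    ((hum.indicator (hT n)).enorm.pow_const _)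
  have hGlim : ∀ x, Tendsto (fun n => G n x) atTop (𝓝 0) := by
    intro x
    refine tendsto_const_nhds.congr' ?_
    filter_upwards [eventually_gt_atTop (⌈‖x‖⌉₊)] with n hn
    have hx : x ∉ {y : E | (n : ℝ) + 1 < ‖y‖} := by
      simp only [mem_setOf_eq, not_lt]
      have : (⌈‖x‖⌉₊ : ℝ) < n := by exact_mod_cast hn
      linarith [Nat.le_ceil ‖x‖]
    show (0 : ℝ≥0∞) = ‖({y : E | (n : ℝ) + 1 < ‖y‖}).indicator u x‖ₑ ^ (6 : ℝ)
    rw [indicator_of_notMem hx, enorm_zero, ENNReal.zero_rpow_of_pos (by norm_num)]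
  have hlin : Tendsto (fun n => ∫⁻ x, G n x ∂μ) atTop (𝓝 (∫⁻ x, (0 : ℝ≥0∞) ∂μ)) :=
    tendsto_lintegral_of_dominated_convergence' (fun x => ‖u x‖ₑ ^ (6 : ℝ)) hGmeas
      (fun n => Eventually.of_forall (hGle n)) hbound (Eventually.of_forall hGlim)
  rw [lintegral_zero] at hlin
  -- back to `eLpNorm`
  have hrpow : Tendsto (fun n => (∫⁻ x, G n x ∂μ) ^ (1 / (6 : ℝ))) atTop (𝓝 ((0 : ℝ≥0∞) ^ (1 / (6 : ℝ)))) :=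
    (ENNReal.continuous_rpow_const.tendsto 0).comp hlin
  rw [ENNReal.zero_rpow_of_pos (by norm_num)] at hrpow
  refine hrpow.congr fun n => ?_
  rw [eLpNorm_eq_lintegral_rpow_enorm_toReal (by norm_num) (by norm_num)]
  simp [hGdef]

/-- **Gagliardo–Nirenberg–Sobolev for `L⁶` fields, dimension three.** On a `3`-dimensional real
inner product space `E` with an additive Haar measure `μ`: for every `C¹` map `u : E → F` with
`‖u‖_{L⁶(μ)} < ∞`, `‖u‖_{L⁶(μ)} ≤ K‖Du‖_{L²(μ)}`, `K = SNormLESNormFDerivOfEqConst F μ 2` — the same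
constant as Mathlib's compactly supported case and as the tree's `L²` version
`eLpNorm_six_le_eLpNorm_fderiv_two`. [cite: Evans2010, §5.6.1 Thm. 1–2] -/
theorem eLpNorm_six_le_eLpNorm_fderiv_two_of_eLpNorm_six_lt_top (μ : Measure E) [μ.IsAddHaarMeasure]
    (hE : finrank ℝ E = 3) {u : E → F} (hu : ContDiff ℝ 1 u) (hu6 : eLpNorm u 6 μ < ∞) :
    eLpNorm u 6 μ ≤ SNormLESNormFDerivOfEqConst F μ 2 * eLpNorm (fderiv ℝ u) 2 μ := by
  obtain ⟨C, hC0, hC⟩ := exists_norm_fderiv_cutoff_le (E := E)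
  set K : ℝ≥0 := SNormLESNormFDerivOfEqConst F μ 2 with hK
  have hum : AEStronglyMeasurable u μ := hu.continuous.aestronglyMeasurable
  -- the truncations `u_n = χ_{n+1} u`
  set uR : ℕ → E → F := fun n x => cutoff ((n : ℝ) + 1) x • u x with huR
  have hRpos : ∀ n : ℕ, (0 : ℝ) < n + 1 := fun n => by positivity
  have h1 : ∀ n, ContDiff ℝ 1 (uR n) := fun n => (contDiff_cutoff _).smul hu
  have h2 : ∀ n, HasCompactSupport (uR n) := fun n =>
    (hasCompactSupport_cutoff (hRpos n)).smul_right
  -- the collar constant `c = 2C μ(B₁)^{1/3}` and the tails `t_n`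
  set c : ℝ≥0∞ := ENNReal.ofReal (2 * C) * μ (ball (0 : E) 1) ^ (1 / 3 : ℝ) with hcdef
  set t : ℕ → ℝ≥0∞ := fun n => eLpNorm (({y : E | (n : ℝ) + 1 < ‖y‖}).indicator u) 6 μ with htdef
  have hc : c ≠ ⊤ := ENNReal.mul_ne_top ENNReal.ofReal_ne_top
    (ENNReal.rpow_ne_top_of_nonneg (by norm_num) (measure_ball_lt_top).ne)
  -- GNS for each truncation + the collar estimate
  have hGNS : ∀ n, eLpNorm (uR n) 6 μ ≤ K * (eLpNorm (fderiv ℝ u) 2 μ + c * t n) := by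
    intro n
    have hp' : ((6 : ℝ≥0) : ℝ)⁻¹ = ((2 : ℝ≥0) : ℝ)⁻¹ - (finrank ℝ E : ℝ)⁻¹ := by
      rw [hE]; norm_num
    have hg := eLpNorm_le_eLpNorm_fderiv_of_eq μ (h1 n) (h2 n) (p := 2) (p' := 6) one_le_two
      (by omega) hp'
    refine (by exact_mod_cast hg :
      eLpNorm (uR n) 6 μ ≤ (K : ℝ≥0∞) * eLpNorm (fderiv ℝ (uR n)) 2 μ).trans ?_
    gcongr
    calc eLpNorm (fderiv ℝ (uR n)) 2 μ
        ≤ eLpNorm (fderiv ℝ u) 2 μ + ENNReal.ofReal (C / ((n : ℝ) + 1)) *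
            eLpNorm (({y : E | (n : ℝ) + 1 < ‖y‖ ∧ ‖y‖ < 2 * ((n : ℝ) + 1)}).indicator u) 2 μ :=
          eLpNorm_fderiv_cutoff_smul_le_indicator μ hu hC0 (hRpos n) (hC _ (hRpos n))
      _ ≤ eLpNorm (fderiv ℝ u) 2 μ + ENNReal.ofReal (C / ((n : ℝ) + 1)) *
            (ENNReal.ofReal (2 * ((n : ℝ) + 1)) * μ (ball (0 : E) 1) ^ (1 / 3 : ℝ) * t n) := by
          gcongr
          exact eLpNorm_two_indicator_shell_le μ hE hum (hRpos n)
      _ = eLpNorm (fderiv ℝ u) 2 μ + c * t n := by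
          rw [hcdef, ← mul_assoc, ← mul_assoc, ← ENNReal.ofReal_mul (by positivity)]
          congr 3
          field_simp
  -- Fatou in `L⁶` and the limit of the right-hand sides
  have hlim : ∀ x, Tendsto (fun n => uR n x) atTop (𝓝 (u x)) := fun x => by
    have := (tendsto_cutoff_natCast_add_one x).smul_const (u x)
    simpa [huR] using this
  have hFatou : eLpNorm u 6 μ ≤ atTop.liminf fun n => eLpNorm (uR n) 6 μ :=
    Lp.eLpNorm_lim_le_liminf_eLpNorm (fun n => (h1 n).continuous.aestronglyMeasurable) u
      (Eventually.of_forall hlim)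
  have htail : Tendsto t atTop (𝓝 0) := tendsto_eLpNorm_indicator_tail_six μ hum hu6
  have hrhs : Tendsto (fun n => (K : ℝ≥0∞) * (eLpNorm (fderiv ℝ u) 2 μ + c * t n)) atTop
      (𝓝 ((K : ℝ≥0∞) * (eLpNorm (fderiv ℝ u) 2 μ + c * 0))) := by
    refine ENNReal.Tendsto.const_mul (tendsto_const_nhds.add ?_) (Or.inr ENNReal.coe_ne_top)
    exact ENNReal.Tendsto.const_mul htail (Or.inr hc)
  calc eLpNorm u 6 μ ≤ atTop.liminf fun n => eLpNorm (uR n) 6 μ := hFatou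
    _ ≤ atTop.liminf fun n => (K : ℝ≥0∞) * (eLpNorm (fderiv ℝ u) 2 μ + c * t n) :=
        liminf_le_liminf (Eventually.of_forall hGNS)
    _ = (K : ℝ≥0∞) * (eLpNorm (fderiv ℝ u) 2 μ + c * 0) := hrhs.liminf_eq
    _ = K * eLpNorm (fderiv ℝ u) 2 μ := by rw [mul_zero, add_zero]

end Literature.Analysis.FluidPDE

end
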